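import Summits.AtomisticToContinuum.HydrodynamicLimit.Theorems.ImplosionDichotomyIdealGasImplosionHolds
import Summits.AtomisticToContinuum.HydrodynamicLimit.Theorems.ImplosionDichotomyDiluteSelfConsistencyPreSingular
import Summits.AtomisticToContinuum.HydrodynamicLimit.Theorems.ImplosionDichotomyImplosionUnboundedDensity

/-!
# `ImplosionDichotomy.ImplosionUnboundedDensity` holds unconditionally

Route `ImplosionDichotomy`, support item stmt-AtomisticToContinuum-12590 (`ImplosionUnboundedDensity`: there are
continuous positive profiles such that for every `M` there is `σ₀ > 0` with, for all `0 < σ < σ₀`, an admissible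
classical hard-sphere Euler solution whose density exceeds `M` somewhere on its interval of existence — the
qualitative loophole: no σ-uniform `L∞` density bound holds along the conjunct's solution class).

The item was CLOSED MODULO two named facts by `implosionUnboundedDensity_proof`
(`ImplosionDichotomyImplosionUnboundedDensity.lean`): the periodic ideal-gas implosion and Kato's continuous
dependence for the hard-sphere Euler family. Both inputs are now THEOREMS of the tree:

* `idealGasImplosion_holds : IdealGasImplosion` (`ImplosionDichotomyIdealGasImplosionHolds.lean`, from
  `typeOneIdealImplosion_holds`);
* `eosContinuity_holds : EosContinuity` (`ImplosionDichotomyDiluteSelfConsistencyPreSingular.lean`, the conditional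
  closer `eosContinuity_proof` fed with the discharged fact `hsEuler_continuousDependence_holds`).

So the planner's glue `implosionUnboundedDensity_of : IdealGasImplosion → EosContinuity → ImplosionUnboundedDensity`
closes the item with the standard axioms only (`propext`, `Classical.choice`, `Quot.sound`).

prover-line-stmt-AtomisticToContinuum-3091-c5-0 (route hygiene while leading the sibling crux stmt-3091).
-/

noncomputable section

namespace Summit.AtomisticToContinuum.HydrodynamicLimit.Theorems

/-- **`ImplosionUnboundedDensity` (stmt-AtomisticToContinuum-12590) holds**: the glue `implosionUnboundedDensity_of`
fed with the tree theorems `idealGasImplosion_holds` (smooth periodic implosion of the monatomic ideal gas with the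
reference data) and `eosContinuity_holds` (existence of admissible σ-solutions beyond any `T₂ < T₁` and their
ε-closeness to the ideal development on `[0, T₂]`): given `M`, pick `T₂` where the ideal density exceeds `M + 1`
and `ε = 1`. [cite: CaolaboraEtAl2025, Thm 1.2 + Rem 1.4 + Rem 1.5] [cite: Kato1975, Thm III] -/
theorem implosionUnboundedDensity_holds :
    Summit.AtomisticToContinuum.HydrodynamicLimit.Theses.ImplosionDichotomy.ImplosionUnboundedDensity :=
  implosionUnboundedDensity_of idealGasImplosion_holds eosContinuity_holds

end Summit.AtomisticToContinuum.HydrodynamicLimit.Theorems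

end
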